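import Literature.Claims.NS.Li2013

/-!
# D-0090 NS-CLAIMS — C23 `Li2013`: kernel refutation of the typed Step 3b (and of its use, Step 3c)

Dongsheng Li, "Existence of Smooth Solutions of the Navier–Stokes Equations", arXiv:1308.3909 **v1** (2013),
45 pp. Skeleton: `Literature.Claims.NS.Li2013` (typist-2, p464990 + v2 p465230; referee ns-claims-ref-3's
pre-registered locator, RETYPE.md v0 18:03Z).

* `not_WeightRatioDisplay` — Step 3b, the display of Lemma 6.3 Step 4, p. 31 (TeX l. 1603–1610):
  "In view of (6.2), (6.13) and `k ≥ 2k₀ = 200`,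
  `(2^{B̂_{[(k+1)/2]}·k/[(k+1)/2]} / 2^{B̂_k})^θ = (2^{k(1/√k − 1/√[(k+1)/2])})^θ`", with the §6 weight (6.2)
  p. 25 `B̂_k = (B − 1/√k)k + 2^B` (additive `2^B`). The exact exponent is
  `B̂_m·k/m − B̂_k = k(1/√k − 1/√m) + 2^B (k/m − 1)` (`bhat_ratio_exponent`); the display drops the summand
  `2^B (k/m − 1)`, which at `B = 10`, `k = 200`, `m = [(201)/2] = 100` equals `2^{10}·(2 − 1) = 1024 ≠ 0`
  (`λ = 1/2`, `θ = thetaExp 200 (1/2) = 99/101 ≠ 0`; `x ↦ x^θ` is injective on `[0,∞)` and `x ↦ 2^x` is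
  injective).
* `not_WeightRatioBound` — Step 3c, the bound the display is used for (p. 31–32, entering (6.15)/(6.10)):
  NO constant `C` independent of `B` bounds the ratio: at `k = 200`, `λ = 1/2` the left side is
  `2^{θ(2^B + √200 − 20)} → ∞` as `B → ∞`, while the right side `C·200^{−10}·2^{−√200/10} ≤ C` is fixed.

Classification (cell vocabulary): false lemma (countermodel) at the scalar grain (TYPING-HYGIENE 13) for the
intermediate display; the load-bearing statement it is proved toward, Theorem 6.1 p. 25 (`Theorem61`,
summit-strength), and its consumers Thm 8.1 / Cor 8.2 / Thm 1.1 are not decided here (unfilled gap).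

WHAT THIS IS NOT: not a claim about NS regularity or blow-up; not a claim about any author beyond the
typed locator.
-/

set_option linter.dupNamespace false

noncomputable section

open Literature.Claims.NS.Li2013

namespace Summit.NavierStokesRegularity.NavierStokesRegularity.Theorems.Li2013

/-- The exact exponent of the weight ratio of Lemma 6.3 Step 4 with (6.2) as printed:
`B̂_m·(k/m) − B̂_k = k(1/√k − 1/√m) + 2^B (k/m − 1)` (`m ≠ 0`). [cite: Li2013, (6.2) p.25; Lemma 6.3 Step 4 p.31] -/
theorem bhat_ratio_exponent (B : ℝ) (k m : ℕ) (hm : (m : ℝ) ≠ 0) :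
    Bhat B m * ((k : ℝ) / (m : ℝ)) - Bhat B k =
      (k : ℝ) * (1 / Real.sqrt k - 1 / Real.sqrt m) + (2 : ℝ) ^ B * ((k : ℝ) / m - 1) := by
  unfold Bhat
  field_simp
  ring

/-- Hence the base of the display: `2^{B̂_m·k/m} / 2^{B̂_k} = 2^{k(1/√k − 1/√m) + 2^B (k/m − 1)}`.
[cite: Li2013, Lemma 6.3 Step 4 p.31] -/
theorem weightRatio_base_eq (B : ℝ) (k m : ℕ) (hm : (m : ℝ) ≠ 0) :
    (2 : ℝ) ^ (Bhat B m * ((k : ℝ) / (m : ℝ))) / (2 : ℝ) ^ Bhat B k =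
      (2 : ℝ) ^ ((k : ℝ) * (1 / Real.sqrt k - 1 / Real.sqrt m) + (2 : ℝ) ^ B * ((k : ℝ) / m - 1)) := by
  rw [← Real.rpow_sub two_pos, bhat_ratio_exponent B k m hm]

/-- The interpolation exponent at `k = 200`, `λ = 1/2`: `θ = 99/101`. [cite: Li2013, Lemma 6.3 Step 3 (6.13) p.30] -/
theorem thetaExp_200_half : thetaExp 200 (1 / 2) = 99 / 101 := by
  unfold thetaExp
  norm_num

/-- `x ↦ 2^x` is strictly monotone on `ℝ` (hence injective). [folklore] -/
theorem two_rpow_strictMono : StrictMono fun x : ℝ => (2 : ℝ) ^ x := fun _ _ hab =>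
  (Real.rpow_lt_rpow_left_iff (by norm_num : (1 : ℝ) < 2)).mpr hab

/-- **Step 3b is false**: the display of Lemma 6.3 Step 4 (p. 31) fails at `B = 10`, `k = 200`
(`m = 100`), `λ = 1/2`: the two bases differ by the factor `2^{2^{10}(200/100 − 1)} = 2^{1024}` and the
common exponent `θ = 99/101` is nonzero. [cite: Li2013, Lemma 6.3 Step 4 p.31] -/
theorem not_WeightRatioDisplay : ¬ WeightRatioDisplay := by
  intro h
  have e := h 10 200 (1 / 2) (by norm_num) le_rfl (by norm_num) (by norm_num)
  rw [weightRatio_base_eq 10 200 ((200 + 1) / 2) (by norm_num), thetaExp_200_half,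
    Real.rpow_left_inj (by positivity) (by positivity) (by norm_num)] at e
  have e2 := two_rpow_strictMono.injective e
  have hm : (((200 + 1) / 2 : ℕ) : ℝ) = 100 := by norm_num
  have h2 : (2 : ℝ) ^ (10 : ℝ) = 1024 := by
    rw [show (10 : ℝ) = ((10 : ℕ) : ℝ) by norm_num, Real.rpow_natCast]; norm_num
  simp only [hm, h2, Nat.cast_ofNat] at e2
  norm_num at e2

/-- Lower bound for the true ratio at `k = 200`, `m = 100`: its exponent exceeds `2^B − 6`
(`√200 > 14`). [cite: Li2013, Lemma 6.3 Step 4 p.31] -/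
theorem ratio_exponent_gt (B : ℝ) :
    (2 : ℝ) ^ B - 6 <
      (200 : ℝ) * (1 / Real.sqrt 200 - 1 / Real.sqrt 100) + (2 : ℝ) ^ B * ((200 : ℝ) / 100 - 1) := by
  have h100 : Real.sqrt 100 = 10 := by
    rw [show (100 : ℝ) = 10 ^ 2 by norm_num, Real.sqrt_sq (by norm_num)]
  have h14 : (14 : ℝ) < Real.sqrt 200 := by
    rw [show (14 : ℝ) = Real.sqrt (14 ^ 2) by rw [Real.sqrt_sq (by norm_num)]]
    exact Real.sqrt_lt_sqrt (by norm_num) (by norm_num)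
  have hpos : 0 < Real.sqrt 200 := by positivity
  have hrec : (200 : ℝ) * (1 / Real.sqrt 200) = Real.sqrt 200 := by
    have hsq : Real.sqrt 200 * Real.sqrt 200 = 200 := Real.mul_self_sqrt (by norm_num)
    field_simp
    linarith [hsq]
  rw [h100, mul_sub, hrec]
  norm_num
  linarith

/-- **Step 3c is false**: no constant `C` independent of `B` bounds the weight ratio — at `k = 200`,
`λ = 1/2` the left side is at least `2^{(99/101)(2^B − 6)}`, unbounded in `B`, while the right side is at
most `C`. Witness for a given `C > 0`: `B = ⌈(101/99)(log₂ C + 1) + 6⌉₊ + 10`.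
[cite: Li2013, Lemma 6.3 Step 4 p.31–32] -/
theorem not_WeightRatioBound : ¬ WeightRatioBound := by
  rintro ⟨C, hC⟩
  -- the right-hand side at k = 200 is at most max C 0
  have hrhs : C * ((200 : ℕ) : ℝ) ^ (-(10 : ℝ)) * (2 : ℝ) ^ (-(Real.sqrt (200 : ℕ) / 10)) ≤ max C 0 := by
    have h1 : ((200 : ℕ) : ℝ) ^ (-(10 : ℝ)) ≤ 1 :=
      Real.rpow_le_one_of_one_le_of_nonpos (by norm_num) (by norm_num)
    have h1' : 0 ≤ ((200 : ℕ) : ℝ) ^ (-(10 : ℝ)) := by positivity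
    have h2 : (2 : ℝ) ^ (-(Real.sqrt (200 : ℕ) / 10)) ≤ 1 :=
      Real.rpow_le_one_of_one_le_of_nonpos (by norm_num)
        (neg_nonpos.mpr (by positivity))
    have h2' : 0 ≤ (2 : ℝ) ^ (-(Real.sqrt (200 : ℕ) / 10)) := by positivity
    calc C * ((200 : ℕ) : ℝ) ^ (-(10 : ℝ)) * (2 : ℝ) ^ (-(Real.sqrt (200 : ℕ) / 10))
        ≤ max C 0 * ((200 : ℕ) : ℝ) ^ (-(10 : ℝ)) * (2 : ℝ) ^ (-(Real.sqrt (200 : ℕ) / 10)) := by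
          gcongr; exact le_max_left _ _
      _ ≤ max C 0 * 1 * 1 := by gcongr
      _ = max C 0 := by ring
  -- choose B with 2^B ≥ T + 6, T := (101/99)(log₂(max C 0 + 1) + 1)
  set M : ℝ := max C 0 + 1 with hM
  have hMpos : 0 < M := by have := le_max_right C 0; linarith
  set T : ℝ := 101 / 99 * (Real.logb 2 M + 1) with hT
  set n : ℕ := ⌈T + 6⌉₊ with hn
  set B : ℝ := (n : ℝ) + 10 with hB
  have hB1 : (1 : ℝ) < B := by have : (0 : ℝ) ≤ n := n.cast_nonneg; linarith
  have h2B : T + 6 ≤ (2 : ℝ) ^ B := by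
    have hnT : T + 6 ≤ (n : ℝ) := Nat.le_ceil _
    have hn2 : (n : ℝ) ≤ (2 : ℝ) ^ (n : ℝ) := by
      rw [Real.rpow_natCast]; exact_mod_cast (Nat.lt_two_pow_self).le
    have hmono : (2 : ℝ) ^ (n : ℝ) ≤ (2 : ℝ) ^ B :=
      Real.rpow_le_rpow_of_exponent_le (by norm_num) (by linarith)
    linarith
  have e := hC B 200 (1 / 2) hB1 le_rfl (by norm_num) (by norm_num)
  rw [weightRatio_base_eq B 200 ((200 + 1) / 2) (by norm_num), thetaExp_200_half] at e
  have hm : (((200 + 1) / 2 : ℕ) : ℝ) = 100 := by norm_num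
  rw [hm] at e
  simp only [Nat.cast_ofNat] at e hrhs
  -- lower bound of the left side
  have hexp : (2 : ℝ) ^ B - 6 <
      (200 : ℝ) * (1 / Real.sqrt 200 - 1 / Real.sqrt 100) + (2 : ℝ) ^ B * ((200 : ℝ) / 100 - 1) :=
    ratio_exponent_gt B
  set E : ℝ := (200 : ℝ) * (1 / Real.sqrt 200 - 1 / Real.sqrt 100) + (2 : ℝ) ^ B * ((200 : ℝ) / 100 - 1)
    with hE
  have hET : T < E := by linarith
  have hlhs : (2 : ℝ) * M ≤ ((2 : ℝ) ^ E) ^ (99 / 101 : ℝ) := by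
    rw [← Real.rpow_mul (by norm_num : (0 : ℝ) ≤ 2)]
    have hlog : Real.logb 2 M + 1 ≤ E * (99 / 101) := by
      have : Real.logb 2 M + 1 = T * (99 / 101) := by rw [hT]; ring
      rw [this]; nlinarith
    calc (2 : ℝ) * M = (2 : ℝ) ^ (Real.logb 2 M + 1) := by
          rw [Real.rpow_add two_pos, Real.rpow_logb two_pos (by norm_num) hMpos, Real.rpow_one]; ring
      _ ≤ (2 : ℝ) ^ (E * (99 / 101)) := Real.rpow_le_rpow_of_exponent_le (by norm_num) hlog
  have : (2 : ℝ) * M ≤ max C 0 := hlhs.trans (e.trans hrhs)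
  rw [hM] at this
  have := le_max_right C 0
  linarith

end Summit.NavierStokesRegularity.NavierStokesRegularity.Theorems.Li2013

end
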